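import Mathlib
import Summits.NavierStokesRegularity.NavierStokesRegularity.Theorems.LerayQuarterDissipationFiniteDissipationLiouvilleWindowBlobProduction
import Summits.NavierStokesRegularity.NavierStokesRegularity.Theorems.LerayQuarterDissipationFiniteDissipationLiouvilleThresholdSecondDerivatives
import Summits.NavierStokesRegularity.NavierStokesRegularity.Theorems.PoloidalWindowDoorPoloidalWindowRigidityVorticityTranslate
import Literature.Analysis.FluidPDE.BarkerPrange2020VorticityAlignmentTypeIHolds
import Literature.Analysis.FluidPDE.NSLocalLerayBackwardUniqueness
import Literature.Analysis.FluidPDE.HarmonicAnalyticContinuation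
import Literature.Analysis.FluidPDE.DerivativeHolderInterpolation
import HarnessLib

/-!
# Crux `FiniteDissipationLiouville` (stmt-NavierStokesRegularity-22144): THE FROZEN-LAW DEFECT — the vorticity of the
# hypothetical singular profile is nowhere locally harmonic: the viscous term `Δω` of the vorticity equation has the
# full self-similar size `δ/t²` somewhere in EVERY parabolic ball of the core, at EVERY instant

Theorems file of route `LerayQuarterDissipation` (lead prover g20; `--supports` the crux; companion of the g20 files
`…CaloricDefect(Windows)` — where `(∂ₜ − Δ)ω ≠ 0` densely — and `…VorticityGradientFloor`). Navier–Stokes regularity is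
NOT proved by anything here; no summit is.

The vorticity equation `∂ₜω + (W·∇)ω − (ω·∇)W = Δω` splits into Euler's FROZEN LAW (left side `= 0`) and viscous
diffusion. The tree has a ONE-SLICE kill for the locus `Δω = 0` (cell ns-regularity-ideate,
`…PoloidalWindowRigidityVorticityTranslate.eq_zero_of_curl_harmonic_slice`: a member of the KNSS-gauge Type-I class
with one harmonic vorticity slice vanishes — bounded harmonic coordinates are constant). This file socket-mounts it:

* `tendsto_iteratedFDeriv_slice_unif` (tool) — along KNSS-convergent sequences of the class ALL spatial derivatives of
  the slices `t = −1` converge uniformly on balls (induction on the order: class-uniform bounds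
  `ThresholdOne.exists_norm_iteratedFDeriv_slice_le` + Landau's two-function interpolation
  `DerivInterp.norm_iteratedFDeriv_succ_sub_le`, one order per round; lead g14 did the first two rounds);
  `tendsto_laplacian_curl_slice` — hence the vorticity Laplacians `Δ(curl v_j(−1))(y)` converge pointwise;
* `eq_zero_of_laplacian_curl_window` — `Δ(curl W s) = 0` on a nonempty open set of ONE slice ⇒ `W ≡ 0` (slice
  analyticity `IsTypeIAncientMild.analyticOnNhd_slice_univ`, `analyticOnNhd_laplacian`, identity theorem, the kill);
* `laplacian_comp_smul`, `laplacian_curl_nsRescale` — `Δ(curl W_c(s))(y) = c⁴ • Δ(curl W(c²s))(cy)`: `t²‖Δω‖` is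
  dimensionless;
* **`laplacianCurl_floor_unit`, `laplacianCurl_floor_every_instant` (+ `_envelope`) — THE EVERY-INSTANT DENSE FLOOR**:
  for all `C, K, ρ, r > 0` there is `δ > 0` such that for every SINGULAR member of `𝒟_{C,K}`, every `t < 0` and every
  centre `‖x₀‖ ≤ ρ√(−t)`, the ball `B(x₀, r√(−t))` contains a point with `t²‖Δ(curl W t)(x)‖ > δ`.

Portrait clause of the registered stub `stub_envelopeCriticalLiouville` (skeleton `Lines/birth.lean`): viscous diffusion
of vorticity acts at full self-similar strength somewhere in every parabolic ball of the core at every instant —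
equivalently Euler's frozen-vorticity law fails there by `δ/t²`; together with `…CaloricDefectWindows` NEITHER half of
the vorticity equation vanishes locally anywhere. Instrument row: a candidate (R)DSS profile with `ΔΩ = 0` on an open
set of one slice is not a counterexample.

HONEST FRAMING. A compactness corollary (ineffective `δ`) of a kill already in the tree, about a HYPOTHETICAL object;
nothing is removed from the DSS wall (`∀ c>1 TypeIDSSLiouville c`, NECESSARY for the crux by `…Hardness`); the verdict
of the line is unchanged (FRONTIER). Nothing here bears on Navier–Stokes regularity.

References: Koch–Nadirashvili–Seregin–Šverák, Acta Math. 203 (2009) §4, Prop. 4.1; E. Landau (1913) / Kolmogorov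
interpolation; P. G. Lemarié-Rieusset (2016), Thm 9.12; folklore.
-/

noncomputable section

set_option linter.dupNamespace false

namespace Summit.NavierStokesRegularity.NavierStokesRegularity.Theorems.FiniteDissipationLiouville.FrozenDefect

open MeasureTheory Set Filter Topology Metric InnerProductSpace Function Real
open scoped RealInnerProductSpace ContDiff ENNReal InnerProductSpace Laplacian
open Literature.Analysis Literature.Analysis.FluidPDE
open Summit.NavierStokesRegularity.NavierStokesRegularity.Theorems
open Summit.NavierStokesRegularity.NavierStokesRegularity.Theorems.RecurrentReductionD
open Summit.NavierStokesRegularity.NavierStokesRegularity.Theorems.FiniteDissipationLiouville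
open Summit.NavierStokesRegularity.NavierStokesRegularity.Theorems.FiniteDissipationLiouville.CrossFlow
open Summit.NavierStokesRegularity.NavierStokesRegularity.Theorems.FiniteDissipationLiouville.Compactness
open Summit.NavierStokesRegularity.NavierStokesRegularity.Theorems.PoloidalWindowDoorPoloidalWindowRigidityVorticityTranslate

variable {C : ℝ} {v : ℕ → ℝ → EuclideanSpace ℝ (Fin 3) → EuclideanSpace ℝ (Fin 3)}
  {W : ℝ → EuclideanSpace ℝ (Fin 3) → EuclideanSpace ℝ (Fin 3)}

/-! ### All derivatives of the slices converge along KNSS-convergent sequences -/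

section Derivatives

/-- Smoothness of the slice `t = −1` of a member of the class, at every point and every finite order. -/
theorem contDiffAt_slice {f : ℝ → EuclideanSpace ℝ (Fin 3) → EuclideanSpace ℝ (Fin 3)}
    (hf : IsTypeIAncientMild C f) (m : ℕ) (z : EuclideanSpace ℝ (Fin 3)) :
    ContDiffAt ℝ (m : ℕ∞) (f (-1)) z :=
  ((hf.contDiff_slice (by norm_num)).of_le (by exact_mod_cast le_top)).contDiffAt

/-- **All spatial derivatives of the slices `t = −1` converge uniformly on balls** along a KNSS-convergent sequence
of the class (induction on the order; one Landau interpolation round per order).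
[cite: KochNadirashviliSereginSverak2009, Prop. 4.1 (arXiv:0709.3599 p. 8)] -/
theorem tendsto_iteratedFDeriv_slice_unif (hv : ∀ j, IsTypeIAncientMild C (v j)) (hW : IsTypeIAncientMild C W)
    (hunif : ∀ n : ℕ, TendstoUniformlyOn (fun j z => v j z.1 z.2) (fun z => W z.1 z.2) atTop
      (Icc (-((n : ℝ) + 2)) (-(1 / ((n : ℝ) + 2))) ×ˢ
        closedBall (0 : EuclideanSpace ℝ (Fin 3)) ((n : ℝ) + 2)))
    (k n : ℕ) {ε : ℝ} (hε : 0 < ε) :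
    ∀ᶠ j in atTop, ∀ y ∈ closedBall (0 : EuclideanSpace ℝ (Fin 3)) ((n : ℝ) + 1),
      ‖iteratedFDeriv ℝ k (v j (-1)) y - iteratedFDeriv ℝ k (W (-1)) y‖ ≤ ε := by
  induction k generalizing n ε with
  | zero =>
    filter_upwards [ThresholdOne.eventually_norm_sub_slice_lt hunif n hε] with j hj
    intro y hy
    have hy' : y ∈ closedBall (0 : EuclideanSpace ℝ (Fin 3)) ((n : ℝ) + 2) :=
      closedBall_subset_closedBall (by linarith) hy
    rw [← iteratedFDeriv_sub_apply (contDiffAt_slice (hv j) 0 y) (contDiffAt_slice hW 0 y),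
      norm_iteratedFDeriv_zero]
    exact (hj y hy').le
  | succ k ih =>
    obtain ⟨K, hK0, hK⟩ := ThresholdOne.exists_norm_iteratedFDeriv_slice_le C (k + 2)
    -- adapted from `…ThresholdSecondDerivatives.tendsto_fderiv_slice_unif` (lead g14)
    set ρ : ℝ := min (1 / 2) (ε / (4 * K + 1)) with hρ
    have hρpos : 0 < ρ := lt_min (by norm_num) (by positivity)
    have hρ1 : ρ < 1 := lt_of_le_of_lt (min_le_left _ _) (by norm_num)
    have hρK : 2 * K * ρ ≤ ε / 2 := by
      have h1 : ρ ≤ ε / (4 * K + 1) := min_le_right _ _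
      have h2 : 2 * K * ρ ≤ 2 * K * (ε / (4 * K + 1)) := mul_le_mul_of_nonneg_left h1 (by positivity)
      have h3 : 2 * K * (ε / (4 * K + 1)) ≤ ε / 2 := by
        rw [show 2 * K * (ε / (4 * K + 1)) = (2 * K * ε) / (4 * K + 1) by ring,
          div_le_div_iff₀ (by positivity) (by norm_num)]
        nlinarith
      linarith
    set A : ℝ := ε * ρ / 4 with hA
    have hApos : 0 < A := by positivity
    have hAρ : 2 * A / ρ = ε / 2 := by rw [hA]; field_simp; ring
    filter_upwards [ih (n + 1) hApos] with j hj
    intro y hy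
    have hball : ∀ z ∈ ball y 1, z ∈ closedBall (0 : EuclideanSpace ℝ (Fin 3)) (((n + 1 : ℕ) : ℝ) + 1) := by
      intro z hz
      rw [mem_closedBall, dist_zero_right] at hy ⊢
      rw [mem_ball, dist_eq_norm] at hz
      have : ‖z‖ ≤ ‖z - y‖ + ‖y‖ := norm_le_norm_sub_add z y
      push_cast
      linarith
    have hle : ((k + 2 : ℕ) : WithTop ℕ∞) ≤ (((k + 2 : ℕ) : ℕ∞) : WithTop ℕ∞) := le_rfl
    have h := DerivInterp.norm_iteratedFDeriv_succ_sub_le (k := k) (N := (((k + 2 : ℕ) : ℕ∞) : WithTop ℕ∞))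
      (x := y) (h := 1) (f₁ := v j (-1)) (f₂ := W (-1))
      (fun z _ => contDiffAt_slice (hv j) (k + 2) z) (fun z _ => contDiffAt_slice hW (k + 2) z) hle
      (A := A) (K := K) (fun z hz => hj z (hball z hz)) hK0 (fun z _ => hK (hv j) z) (fun z _ => hK hW z)
      hρpos hρ1
    calc ‖iteratedFDeriv ℝ (k + 1) (v j (-1)) y - iteratedFDeriv ℝ (k + 1) (W (-1)) y‖
        ≤ 2 * A / ρ + 2 * K * ρ := h
      _ ≤ ε / 2 + ε / 2 := by rw [hAρ]; exact add_le_add le_rfl hρK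
      _ = ε := by ring

/-- Pointwise convergence of the iterated derivatives of the slices `t = −1`.
[cite: KochNadirashviliSereginSverak2009, Prop. 4.1 (arXiv:0709.3599 p. 8)] -/
theorem tendsto_iteratedFDeriv_slice (hv : ∀ j, IsTypeIAncientMild C (v j)) (hW : IsTypeIAncientMild C W)
    (hunif : ∀ n : ℕ, TendstoUniformlyOn (fun j z => v j z.1 z.2) (fun z => W z.1 z.2) atTop
      (Icc (-((n : ℝ) + 2)) (-(1 / ((n : ℝ) + 2))) ×ˢ
        closedBall (0 : EuclideanSpace ℝ (Fin 3)) ((n : ℝ) + 2)))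
    (k : ℕ) (y : EuclideanSpace ℝ (Fin 3)) :
    Tendsto (fun j => iteratedFDeriv ℝ k (v j (-1)) y) atTop (𝓝 (iteratedFDeriv ℝ k (W (-1)) y)) := by
  rw [Metric.tendsto_atTop]
  intro ε hε
  obtain ⟨n, hn⟩ := exists_nat_ge ‖y‖
  have hy : y ∈ closedBall (0 : EuclideanSpace ℝ (Fin 3)) ((n : ℝ) + 1) := by
    rw [mem_closedBall, dist_zero_right]; linarith
  obtain ⟨N, hN⟩ := Filter.eventually_atTop.1
    (tendsto_iteratedFDeriv_slice_unif hv hW hunif k n (half_pos hε))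
  refine ⟨N, fun j hj => ?_⟩
  rw [dist_eq_norm]
  exact (hN j hj y hy).trans_lt (half_lt_self hε)

/-- **The vorticity Laplacians of the slices `t = −1` converge pointwise** along a KNSS-convergent sequence:
`‖D²(curl f − curl g)‖ ≤ ‖curlCLM‖·‖D³(f − g)‖` and the Laplacian is a finite sum of evaluations of `D²`.
[cite: KochNadirashviliSereginSverak2009, Prop. 4.1 (arXiv:0709.3599 p. 8)] -/
theorem tendsto_laplacian_curl_slice (hv : ∀ j, IsTypeIAncientMild C (v j)) (hW : IsTypeIAncientMild C W)
    (hunif : ∀ n : ℕ, TendstoUniformlyOn (fun j z => v j z.1 z.2) (fun z => W z.1 z.2) atTop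
      (Icc (-((n : ℝ) + 2)) (-(1 / ((n : ℝ) + 2))) ×ˢ
        closedBall (0 : EuclideanSpace ℝ (Fin 3)) ((n : ℝ) + 2)))
    (y : EuclideanSpace ℝ (Fin 3)) :
    Tendsto (fun j => (Δ (curl (v j (-1)))) y) atTop (𝓝 ((Δ (curl (W (-1)))) y)) := by
  set L : (EuclideanSpace ℝ (Fin 3) →L[ℝ] EuclideanSpace ℝ (Fin 3)) →L[ℝ] EuclideanSpace ℝ (Fin 3) := curlCLM
    with hL
  -- smoothness bookkeeping
  have hsm : ∀ {f : ℝ → EuclideanSpace ℝ (Fin 3) → EuclideanSpace ℝ (Fin 3)}, IsTypeIAncientMild C f →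
      ContDiff ℝ 4 (f (-1)) := fun hf =>
    (hf.contDiff_slice (by norm_num)).of_le (WithTop.coe_le_coe.mpr le_top)
  have hcurl2 : ∀ {f : ℝ → EuclideanSpace ℝ (Fin 3) → EuclideanSpace ℝ (Fin 3)}, IsTypeIAncientMild C f →
      ContDiff ℝ 2 (curl (f (-1))) := fun hf => by
    rw [curl_eq_curlCLM_comp]
    exact L.contDiff.comp ((hsm hf).fderiv_right (m := 2) (by norm_cast))
  -- ## the `D²(curl)` differences are controlled by the `D³` differences
  have key : ∀ j, ‖iteratedFDeriv ℝ 2 (curl (v j (-1))) y - iteratedFDeriv ℝ 2 (curl (W (-1))) y‖ ≤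
      ‖L‖ * ‖iteratedFDeriv ℝ 3 (v j (-1)) y - iteratedFDeriv ℝ 3 (W (-1)) y‖ := by
    intro j
    have hdiff : ContDiff ℝ 4 (v j (-1) - W (-1)) := (hsm (hv j)).sub (hsm hW)
    have e1 : curl (v j (-1)) - curl (W (-1)) = L ∘ fderiv ℝ (v j (-1) - W (-1)) := by
      funext z
      simp only [Pi.sub_apply, Function.comp_apply, hL, curl_eq_curlCLM]
      rw [fderiv_sub ((hsm (hv j)).differentiable (by norm_cast) z) ((hsm hW).differentiable (by norm_cast) z),
        map_sub]
    rw [← iteratedFDeriv_sub_apply (hcurl2 (hv j)).contDiffAt (hcurl2 hW).contDiffAt, e1]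
    have hfd : ContDiffAt ℝ ((2 : ℕ) : WithTop ℕ∞) (fderiv ℝ (v j (-1) - W (-1))) y :=
      (hdiff.fderiv_right (m := 2) (by norm_cast)).contDiffAt
    calc ‖iteratedFDeriv ℝ 2 (L ∘ fderiv ℝ (v j (-1) - W (-1))) y‖
        ≤ ‖L‖ * ‖iteratedFDeriv ℝ 2 (fderiv ℝ (v j (-1) - W (-1))) y‖ :=
          L.norm_iteratedFDeriv_comp_left hfd le_rfl
      _ = ‖L‖ * ‖iteratedFDeriv ℝ 3 (v j (-1) - W (-1)) y‖ := by rw [norm_iteratedFDeriv_fderiv]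
      _ = ‖L‖ * ‖iteratedFDeriv ℝ 3 (v j (-1)) y - iteratedFDeriv ℝ 3 (W (-1)) y‖ := by
          rw [iteratedFDeriv_sub_apply (contDiffAt_slice (hv j) 3 y) (contDiffAt_slice hW 3 y)]
  -- ## hence `D²(curl v_j(−1))(y) → D²(curl W(−1))(y)`
  have h3 := tendsto_iteratedFDeriv_slice hv hW hunif 3 y
  have h2c : Tendsto (fun j => iteratedFDeriv ℝ 2 (curl (v j (-1))) y) atTop
      (𝓝 (iteratedFDeriv ℝ 2 (curl (W (-1))) y)) := by
    rw [tendsto_iff_norm_sub_tendsto_zero]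
    have h0 : Tendsto (fun j => ‖L‖ * ‖iteratedFDeriv ℝ 3 (v j (-1)) y - iteratedFDeriv ℝ 3 (W (-1)) y‖)
        atTop (𝓝 0) := by
      have := (tendsto_iff_norm_sub_tendsto_zero.1 h3).const_mul ‖L‖
      simpa using this
    exact squeeze_zero (fun _ => norm_nonneg _) key h0
  -- ## the Laplacian is a finite sum of evaluations of `D²`
  set b := stdOrthonormalBasis ℝ (EuclideanSpace ℝ (Fin 3))
  have eΔ : ∀ (g : EuclideanSpace ℝ (Fin 3) → EuclideanSpace ℝ (Fin 3)) (z : EuclideanSpace ℝ (Fin 3)),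
      (Δ g) z = ∑ i, iteratedFDeriv ℝ 2 g z ![b i, b i] := fun g z => by
    rw [laplacian_eq_iteratedFDeriv_stdOrthonormalBasis g]
  simp_rw [eΔ]
  refine tendsto_finsetSum _ fun i _ => ?_
  exact ((ContinuousMultilinearMap.apply ℝ (fun _ : Fin 2 => EuclideanSpace ℝ (Fin 3)) (EuclideanSpace ℝ (Fin 3))
    ![b i, b i]).continuous.tendsto _).comp h2c

end Derivatives

/-! ### The one-slice kill: a locally harmonic vorticity slice forces `W ≡ 0` -/

section Kill

/-- The vorticity Laplacian of a slice of a member of the class is real-analytic. [cite: LemarieRieusset2016, Thm. 9.12 (PDF p. 260)] -/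
theorem analyticOnNhd_laplacian_curl_slice (hW : IsTypeIAncientMild C W) {s : ℝ} (hs : s < 0) :
    AnalyticOnNhd ℝ (Δ (curl (W s))) univ :=
  analyticOnNhd_laplacian (Literature.Analysis.FluidPDE.analyticOnNhd_curl (hW.analyticOnNhd_slice_univ hs))

/-- **THE KILL (imported by name): a member of the class whose vorticity is harmonic on a nonempty open set of ONE
slice is identically zero** (identity theorem + tree `…VorticityTranslate.eq_zero_of_curl_harmonic_slice`).
[cite: KochNadirashviliSereginSverak2009, §4 (arXiv:0709.3599 p. 8)] -/
theorem eq_zero_of_laplacian_curl_window (hW : IsTypeIAncientMild C W) {s : ℝ} (hs : s < 0)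
    {U : Set (EuclideanSpace ℝ (Fin 3))} (hU : IsOpen U) (hne : U.Nonempty)
    (h : ∀ y ∈ U, (Δ (curl (W s))) y = 0) : ∀ t < 0, ∀ x, W t x = 0 := by
  obtain ⟨y₀, hy₀⟩ := hne
  have han := analyticOnNhd_laplacian_curl_slice hW hs
  have hev : Δ (curl (W s)) =ᶠ[𝓝 y₀] 0 :=
    Filter.eventually_of_mem (hU.mem_nhds hy₀) fun y hy => by simpa only [Pi.zero_apply] using h y hy
  have hall : ∀ y, (Δ (curl (W s))) y = 0 := fun y => by
    have := han.eqOn_zero_of_preconnected_of_eventuallyEq_zero isPreconnected_univ (mem_univ y₀) hev (mem_univ y)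
    simpa using this
  exact eq_zero_of_curl_harmonic_slice hW.hasTypeITimeDecay hW.continuousOn_uncurry
    (fun _ _ hst ht x => hW.mild_eq_heatExtension hst ht x) (fun _ ht => hW.isDivFree ht) hs hall

end Kill

/-! ### Scale covariance of the vorticity Laplacian -/

section Scaling

/-- `Δ(g ∘ (c • ·))(x) = c² • (Δ g)(c x)` for a `C²` map. [folklore] -/
theorem laplacian_comp_smul {g : EuclideanSpace ℝ (Fin 3) → EuclideanSpace ℝ (Fin 3)} (hg : ContDiff ℝ 2 g)
    (c : ℝ) (x : EuclideanSpace ℝ (Fin 3)) :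
    (Δ (fun y => g (c • y))) x = c ^ 2 • (Δ g) (c • x) := by
  rw [laplacian_eq_iteratedFDeriv_stdOrthonormalBasis, laplacian_eq_iteratedFDeriv_stdOrthonormalBasis]
  simp only
  have hcomp : (fun y => g (c • y)) = g ∘ (c • ContinuousLinearMap.id ℝ (EuclideanSpace ℝ (Fin 3))) := by
    funext y; simp
  rw [hcomp, ContinuousLinearMap.iteratedFDeriv_comp_right _ hg x (i := 2) le_rfl, Finset.smul_sum]
  refine Finset.sum_congr rfl fun i _ => ?_
  rw [ContinuousMultilinearMap.compContinuousLinearMap_apply]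
  have e : (fun k : Fin 2 => (c • ContinuousLinearMap.id ℝ (EuclideanSpace ℝ (Fin 3)))
      (![(stdOrthonormalBasis ℝ (EuclideanSpace ℝ (Fin 3))) i, (stdOrthonormalBasis ℝ (EuclideanSpace ℝ (Fin 3))) i] k)) =
      fun k => (fun _ : Fin 2 => c) k •
        ![(stdOrthonormalBasis ℝ (EuclideanSpace ℝ (Fin 3))) i, (stdOrthonormalBasis ℝ (EuclideanSpace ℝ (Fin 3))) i] k := by
    funext k; simp
  rw [show (c • ContinuousLinearMap.id ℝ (EuclideanSpace ℝ (Fin 3))) x = c • x by simp, e,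
    ContinuousMultilinearMap.map_smul_univ]
  simp [pow_two]

/-- **`Δ(curl W_c(s))(y) = c⁴ • Δ(curl W(c²s))(c y)`** for the parabolic rescaling of a field whose slice `c²s` is `C³`.
[folklore] -/
theorem laplacian_curl_nsRescale {V : ℝ → EuclideanSpace ℝ (Fin 3) → EuclideanSpace ℝ (Fin 3)} {c s : ℝ}
    (hV : ContDiff ℝ 3 (V (c ^ 2 * s))) (y : EuclideanSpace ℝ (Fin 3)) :
    (Δ (curl (nsRescale c V s))) y = (c * c * c * c) • (Δ (curl (V (c ^ 2 * s)))) (c • y) := by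
  have hg : ContDiff ℝ 2 (curl (V (c ^ 2 * s))) := by
    rw [curl_eq_curlCLM_comp]
    exact curlCLM.contDiff.comp (hV.fderiv_right (m := 2) (by norm_cast))
  have e : curl (nsRescale c V s) =
      (c * c) • (fun z : EuclideanSpace ℝ (Fin 3) => curl (V (c ^ 2 * s)) (c • z)) := by
    funext z
    rw [Pi.smul_apply, curl_eq_curlCLM, curl_eq_curlCLM, fderiv_nsRescale, map_smul]
  have hcomp : ContDiffAt ℝ 2 (fun z : EuclideanSpace ℝ (Fin 3) => curl (V (c ^ 2 * s)) (c • z)) y :=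
    (hg.comp (contDiff_const_smul c)).contDiffAt
  rw [e, laplacian_smul _ hcomp, laplacian_comp_smul hg c y, smul_smul]
  congr 1
  ring

end Scaling

/-! ### The every-instant dense floor -/

section Dense

/-- **THE DENSE FLOOR AT THE UNIT SLICE (crux frame)**: for all `C, K, ρ, r > 0` a `δ > 0` such that for every singular
member `V` of `𝒟_{C,K}` and every centre `‖x₀‖ ≤ ρ` some `x ∈ B(x₀, r)` has `‖Δ(curl V(−1))(x)‖ > δ`.
[one-slice kill + slice analyticity + KNSS compactness; cite: KochNadirashviliSereginSverak2009, §4 (arXiv:0709.3599 p. 8)] -/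
theorem laplacianCurl_floor_unit (C K : ℝ) {ρ r : ℝ} (hr : 0 < r) :
    ∃ δ : ℝ, 0 < δ ∧
    ∀ (V : ℝ → EuclideanSpace ℝ (Fin 3) → EuclideanSpace ℝ (Fin 3)), IsTypeIAncientMild C V →
      (∀ s : ℝ, s < 0 → ∫⁻ x, ‖fderiv ℝ (V s) x‖ₑ ^ 2 ≤ ENNReal.ofReal (K / Real.sqrt (-s))) →
      (∀ r > 0, ∀ M : ℝ, ∃ t ∈ Ioo (-(r ^ 2)) (0 : ℝ),
        ∃ x ∈ ball (0 : EuclideanSpace ℝ (Fin 3)) r, M < ‖V t x‖) →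
      ∀ x₀ : EuclideanSpace ℝ (Fin 3), ‖x₀‖ ≤ ρ →
        ∃ x ∈ ball x₀ r, δ < ‖(Δ (curl (V (-1)))) x‖ := by
  by_contra hcon
  push Not at hcon
  have hbad : ∀ j : ℕ, ∃ (V : ℝ → EuclideanSpace ℝ (Fin 3) → EuclideanSpace ℝ (Fin 3))
      (x₀ : EuclideanSpace ℝ (Fin 3)), IsTypeIAncientMild C V ∧
      (∀ s : ℝ, s < 0 → ∫⁻ x, ‖fderiv ℝ (V s) x‖ₑ ^ 2 ≤ ENNReal.ofReal (K / Real.sqrt (-s))) ∧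
      (∀ r > 0, ∀ M : ℝ, ∃ t ∈ Ioo (-(r ^ 2)) (0 : ℝ),
        ∃ x ∈ ball (0 : EuclideanSpace ℝ (Fin 3)) r, M < ‖V t x‖) ∧ ‖x₀‖ ≤ ρ ∧
      ∀ x ∈ ball x₀ r, ‖(Δ (curl (V (-1)))) x‖ ≤ 1 / ((j : ℝ) + 1) := by
    intro j
    obtain ⟨V, hV, hlaw, hsing, x₀, hx₀, hno⟩ := hcon (1 / ((j : ℝ) + 1)) (by positivity)
    exact ⟨V, x₀, hV, hlaw, hsing, hx₀, hno⟩
  choose V x₀ hV hlaw hsing hx₀ hsmall using hbad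
  obtain ⟨xinf, -, φ, hφ, hxlim⟩ := (isCompact_closedBall (0 : EuclideanSpace ℝ (Fin 3)) ρ).tendsto_subseq
    (fun j => mem_closedBall_zero_iff.2 (hx₀ j))
  obtain ⟨ψ, hψ, W, hW, hunif, -, -⟩ := Compactness.seqLimit (w := fun j => V (φ j)) (fun j => hV _)
  have hψt : Tendsto ψ atTop atTop := hψ.tendsto_atTop
  have hWsing := Compactness.persistent_singularity_seq (w := fun j => V (φ (ψ j)))
    (fun j => hV _) (fun j => hlaw _) (fun j => hsing _) hW hunif
  have hzero : ∀ x ∈ ball xinf r, (Δ (curl (W (-1)))) x = 0 := by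
    intro x hx
    have hL := tendsto_laplacian_curl_slice (v := fun j => V (φ (ψ j))) (fun j => hV _) hW hunif x
    have hxlim' : Tendsto (fun j => x₀ (φ (ψ j))) atTop (𝓝 xinf) := hxlim.comp hψt
    have hxr : dist x xinf < r := mem_ball.1 hx
    have hxev : ∀ᶠ j in atTop, x ∈ ball (x₀ (φ (ψ j))) r := by
      have hd : ∀ᶠ j in atTop, dist (x₀ (φ (ψ j))) xinf < r - dist x xinf :=
        Metric.tendsto_nhds.1 hxlim' _ (by linarith)
      filter_upwards [hd] with j hj
      rw [mem_ball]
      calc dist x (x₀ (φ (ψ j))) ≤ dist x xinf + dist xinf (x₀ (φ (ψ j))) := dist_triangle _ _ _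
        _ = dist x xinf + dist (x₀ (φ (ψ j))) xinf := by rw [dist_comm xinf]
        _ < r := by linarith
    have hφψ : Tendsto (fun j => φ (ψ j)) atTop atTop := hφ.tendsto_atTop.comp hψt
    have hεj : Tendsto (fun j => 1 / (((φ (ψ j) : ℕ) : ℝ) + 1)) atTop (𝓝 0) :=
      tendsto_one_div_add_atTop_nhds_zero_nat.comp hφψ
    have hle : ‖(Δ (curl (W (-1)))) x‖ ≤ 0 :=
      le_of_tendsto_of_tendsto hL.norm hεj (hxev.mono fun j hj => hsmall (φ (ψ j)) x hj)
    exact norm_le_zero_iff.1 hle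
  have hW0 := eq_zero_of_laplacian_curl_window hW (s := -1) (by norm_num) isOpen_ball ⟨xinf, mem_ball_self hr⟩ hzero
  obtain ⟨t, ht, x, -, hM⟩ := hWsing 1 one_pos 0
  rw [hW0 t ht.2 x, norm_zero] at hM
  exact lt_irrefl _ hM

/-- **THE DENSE FROZEN-LAW DEFECT AT EVERY INSTANT (crux frame)**: for all `C, K, ρ, r > 0` a `δ > 0` such that for
every singular member of `𝒟_{C,K}`, every `t < 0` and every `‖x₀‖ ≤ ρ√(−t)`, some `x ∈ B(x₀, r√(−t))` has
`t²‖Δ(curl W t)(x)‖ > δ`. [cite: KochNadirashviliSereginSverak2009, §4 (arXiv:0709.3599 p. 8)] -/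
theorem laplacianCurl_floor_every_instant (C K : ℝ) {ρ r : ℝ} (hr : 0 < r) :
    ∃ δ : ℝ, 0 < δ ∧
    ∀ (V : ℝ → EuclideanSpace ℝ (Fin 3) → EuclideanSpace ℝ (Fin 3)), IsTypeIAncientMild C V →
      (∀ s : ℝ, s < 0 → ∫⁻ x, ‖fderiv ℝ (V s) x‖ₑ ^ 2 ≤ ENNReal.ofReal (K / Real.sqrt (-s))) →
      (∀ r > 0, ∀ M : ℝ, ∃ t ∈ Ioo (-(r ^ 2)) (0 : ℝ),
        ∃ x ∈ ball (0 : EuclideanSpace ℝ (Fin 3)) r, M < ‖V t x‖) →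
      ∀ t : ℝ, t < 0 → ∀ x₀ : EuclideanSpace ℝ (Fin 3), ‖x₀‖ ≤ ρ * Real.sqrt (-t) →
        ∃ x ∈ ball x₀ (r * Real.sqrt (-t)), δ < t ^ 2 * ‖(Δ (curl (V t))) x‖ := by
  obtain ⟨δ, hδ, h⟩ := laplacianCurl_floor_unit C K (ρ := ρ) hr
  refine ⟨δ, hδ, fun V hV hlaw hsing t ht x₀ hx₀ => ?_⟩
  set c : ℝ := Real.sqrt (-t) with hcdef
  have hc : 0 < c := Real.sqrt_pos.2 (neg_pos.2 ht)
  have hc2 : c ^ 2 * (-1) = t := by rw [hcdef, Real.sq_sqrt (neg_pos.2 ht).le]; ring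
  have hc4 : c * c * c * c = t ^ 2 := by nlinarith [hc2]
  have hx₀' : ‖c⁻¹ • x₀‖ ≤ ρ := by
    rw [norm_smul, norm_inv, Real.norm_of_nonneg hc.le, inv_mul_le_iff₀ hc, mul_comm]
    exact hx₀
  obtain ⟨x, hx, hδx⟩ := h (nsRescale c V) (hV.nsRescale hc) (dissipationLaw_nsRescale hlaw hc)
    (singularAtOrigin_nsRescale hsing hc) (c⁻¹ • x₀) hx₀'
  refine ⟨c • x, ?_, ?_⟩
  · rw [mem_ball, dist_eq_norm] at hx ⊢
    have e : c • x - x₀ = c • (x - c⁻¹ • x₀) := by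
      rw [smul_sub, smul_smul, mul_inv_cancel₀ hc.ne', one_smul]
    rw [e, norm_smul, Real.norm_of_nonneg hc.le]
    calc c * ‖x - c⁻¹ • x₀‖ < c * r := mul_lt_mul_of_pos_left hx hc
      _ = r * c := mul_comm _ _
  · have hV3 : ContDiff ℝ 3 (V (c ^ 2 * (-1))) := by
      rw [hc2]; exact (hV.contDiff_slice ht).of_le (WithTop.coe_le_coe.mpr le_top)
    rw [laplacian_curl_nsRescale hV3 x, hc2, norm_smul, Real.norm_of_nonneg (by positivity : (0 : ℝ) ≤ c * c * c * c),
      hc4] at hδx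
    exact hδx

/-- **THE DENSE FROZEN-LAW DEFECT ON THE ENVELOPED CLASS (law-free).** [cite: KochNadirashviliSereginSverak2009, §4 (arXiv:0709.3599 p. 8)] -/
theorem laplacianCurl_floor_every_instant_envelope (A : ℝ) {ρ r : ℝ} (hr : 0 < r) :
    ∃ δ : ℝ, 0 < δ ∧
    ∀ (C : ℝ) (V : ℝ → EuclideanSpace ℝ (Fin 3) → EuclideanSpace ℝ (Fin 3)), IsTypeIAncientMild C V → C ≤ A →
      HasTypeIDecay A V →
      (∀ r > 0, ∀ M : ℝ, ∃ t ∈ Ioo (-(r ^ 2)) (0 : ℝ),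
        ∃ x ∈ ball (0 : EuclideanSpace ℝ (Fin 3)) r, M < ‖V t x‖) →
      ∀ t : ℝ, t < 0 → ∀ x₀ : EuclideanSpace ℝ (Fin 3), ‖x₀‖ ≤ ρ * Real.sqrt (-t) →
        ∃ x ∈ ball x₀ (r * Real.sqrt (-t)), δ < t ^ 2 * ‖(Δ (curl (V t))) x‖ := by
  obtain ⟨K, hK⟩ := LambProduct.exists_uniform_law_of_envelope A
  obtain ⟨δ, hδ, h⟩ := laplacianCurl_floor_every_instant A K (ρ := ρ) hr
  exact ⟨δ, hδ, fun C V hV hCA hdec hsing => h V (isTypeIAncientMild_of_le hV hCA)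
    (hK (isTypeIAncientMild_of_le hV hCA) hdec) hsing⟩

end Dense

end Summit.NavierStokesRegularity.NavierStokesRegularity.Theorems.FiniteDissipationLiouville.FrozenDefect

end
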